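import Mathlib
import HarnessLib
import Literature.Analysis.FluidPDE.TypeIAncientMild
import Summits.NavierStokesRegularity.NavierStokesRegularity.Theorems.LiouvilleConjectureNS
import Summits.NavierStokesRegularity.NavierStokesRegularity.Theses.TypeILiouville
import Summits.NavierStokesRegularity.NavierStokesRegularity.Theorems.PoloidalWindowDoorPoloidalWindowRigidityWindow
import Summits.NavierStokesRegularity.NavierStokesRegularity.Theorems.AxisTwistDoorTiltDominationLocSymmetryExclusions
import Summits.NavierStokesRegularity.NavierStokesRegularity.Theorems.PoloidalWindowDoorOfNoLocalTypeI

/-!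
# AxisTwistDoor · crux `TiltDominationLoc` (stmt-NavierStokesRegularity-26991) — W3 SITS UNDER H2: the crux follows
# from the Liouville conjecture (L) (item 10661 `TypeILiouville.TypeIliouvilleL` ≡ leaf `LiouvilleConjectureNS`)

Kernel edge for the NS wall board (`ladder-directors/WALL-BOARD-NS.md`): wall W3 = crux 26991 is implied by the hard
core H2 = the Koch–Nadirashvili–Seregin–Šverák Liouville conjecture (L).  By `…EnergyClass.oneSignedRigidity_iff_core`
(p643972) W3 is «no Type-I ancient Oseen-mild profile with `ω₃ ≥ 0` is backward-singular at the apex»; under (L)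
there is no non-zero Type-I ancient Oseen-mild profile at all, whatever the sign:

* `eq_zero_of_liouvilleConjectureNS` — (L) ⇒ every profile of the route's four-hypothesis class vanishes identically:
  the time-shifted copies `t ↦ v(t − δ)` are BOUNDED ancient mild solutions in the duality form of (L)
  (`IsTypeIAncientMild.isBoundedAncientMildSolution_sub`) with continuous slices, so under (L) every slice of `v` is
  (a.e., hence everywhere) spatially constant, and the Oseen gauge kills slice-constant elements
  (`IsTypeIAncientMild.eq_zero_of_slice_const`, KNSS 2009 Rem 6.1);
* `oneSignedRigidity_of_liouvilleConjectureNS`, `tiltDominationLoc_of_liouvilleConjectureNS` — hence (L) ⇒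
  `OneSignedRigidity` ⇒ `TiltDominationLoc` (`…Rigidity.tiltDominationLoc_iff_oneSignedRigidity`);
* `tiltDominationLoc_of_typeIliouvilleL` — the same from the ROUTE ITEM `TypeILiouville.TypeIliouvilleL` (stmt-10661,
  definitionally the leaf), i.e. the board edge W3 ⟸ H2 by name.

WHAT THIS IS NOT: (L) is OPEN (item 10661); nothing here proves 26991, any wall, the leaf or any Navier–Stokes
regularity statement (Clay A OPEN).  Seat ns-atd-p1 (LEAD g4).  [cite: KochNadirashviliSereginSverak2009, §1
(conjecture (L)) and Remark 6.1; AlbrittonBarker2019, §1 after Thm 1.1 («(L) excludes Type I»)]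
-/

noncomputable section

-- the summit and its single sub-problem share the name (CONVENTIONS §1), as in every Theorems file
set_option linter.dupNamespace false

namespace Summit.NavierStokesRegularity.NavierStokesRegularity.Theorems.AxisTwistDoorTiltDominationLocOfLiouville

open Set Function Filter Topology MeasureTheory Metric
open scoped ENNReal InnerProductSpace
open Literature.Analysis Literature.Analysis.FluidPDE
open Summit.NavierStokesRegularity.NavierStokesRegularity.Theses.AxisTwistDoor
open Summit.NavierStokesRegularity.NavierStokesRegularity.Theorems.AxisTwistDoorTiltDominationLocDefs
open Summit.NavierStokesRegularity.NavierStokesRegularity.Theorems.PoloidalWindowDoorPoloidalWindowRigidityWindow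
  (isTypeIAncientMild_of_class)

variable {C : ℝ} {v : ℝ → EuclideanSpace ℝ (Fin 3) → EuclideanSpace ℝ (Fin 3)}

/-- **(L) kills the whole Type-I Oseen-mild class.**  Under the Liouville conjecture `LiouvilleConjectureNS`, a
Type-I ancient mild field (`IsTypeIAncientMild C v`) vanishes identically on the open backward slab: its time-shifted
copies are bounded ancient mild solutions with continuous slices, so every slice of `v` is spatially constant, and
slice-constant elements of the class are zero (KNSS 2009 Rem 6.1, `eq_zero_of_slice_const`). [cite:
KochNadirashviliSereginSverak2009, §1 and Remark 6.1 (arXiv:0709.3599); AlbrittonBarker2019, §1 after Thm 1.1] -/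
theorem eq_zero_of_typeIAncientMild_of_liouvilleConjectureNS
    (hL : Summit.NavierStokesRegularity.NavierStokesRegularity.LiouvilleConjectureNS)
    (hv : IsTypeIAncientMild C v) : ∀ t < (0 : ℝ), ∀ x, v t x = 0 := by
  -- every slice is spatially constant
  have hconst : ∀ t < (0 : ℝ), ∃ b : EuclideanSpace ℝ (Fin 3), ∀ x, v t x = b := by
    intro t ht
    set δ : ℝ := -t / 2 with hδ
    have hδ0 : 0 < δ := by rw [hδ]; linarith
    have hu := hv.isBoundedAncientMildSolution_sub hδ0
    have hmeas : ∀ τ < (0 : ℝ), AEStronglyMeasurable ((fun τ => v (τ - δ)) τ) volume :=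
      fun τ hτ => hv.aestronglyMeasurable_slice (by linarith)
    have hτ : t + δ < 0 := by rw [hδ]; linarith
    obtain ⟨b, hb⟩ := hL _ hu hmeas (t + δ) hτ
    have hb' : v t =ᵐ[volume] fun _ => b := by
      have hb2 : v (t + δ - δ) =ᵐ[volume] fun _ => b := hb
      rwa [add_sub_cancel_right] at hb2
    have heq : v t = fun _ => b :=
      (Continuous.ae_eq_iff_eq volume (hv.continuous_slice ht) continuous_const).1 hb'
    exact ⟨b, fun x => congrFun heq x⟩
  choose! b hb using hconst
  exact fun t ht x => hv.eq_zero_of_slice_const (b := b) (fun t ht x => hb t ht x) ht x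

/-- **(L) ⇒ the route's class is empty of non-zero profiles** (four-hypothesis form). [cite: KochNadirashviliSereginSverak2009,
§1 and Remark 6.1 (arXiv:0709.3599)] -/
theorem eq_zero_of_liouvilleConjectureNS
    (hL : Summit.NavierStokesRegularity.NavierStokesRegularity.LiouvilleConjectureNS)
    (hrate : HasTypeITimeDecay C v) (hcont : ContinuousOn (uncurry v) (Iio (0 : ℝ) ×ˢ univ))
    (hmild : ∀ s t : ℝ, s < t → t < 0 → ∀ x,
      v t x = UnboundedOperators.heatExtension (v s) (t - s) x - oseenDuhamel 1 s v v t x)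
    (hdiv : ∀ t < 0, VectorCalculus.IsDivFree (v t)) : ∀ t < (0 : ℝ), ∀ x, v t x = 0 :=
  eq_zero_of_typeIAncientMild_of_liouvilleConjectureNS hL (isTypeIAncientMild_of_class hrate hcont hmild hdiv)

/-- **W3 ⟸ H2**: the Liouville conjecture (L) implies `OneSignedRigidity` (the one-signed Type-I Liouville statement
of the dictionary), the sign not even being used. [cite: KochNadirashviliSereginSverak2009, §1] -/
theorem oneSignedRigidity_of_liouvilleConjectureNS
    (hL : Summit.NavierStokesRegularity.NavierStokesRegularity.LiouvilleConjectureNS) : OneSignedRigidity :=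
  fun _ _ _ _ hrate hcont hmild hdiv _ _ _ _ _ =>
    AxisTwistDoorTiltDominationLocSymmetryExclusions.not_isBackwardSingularPoint_of_eq_zero
      (eq_zero_of_liouvilleConjectureNS hL hrate hcont hmild hdiv)

/-- **W3 ⟸ H2, crux form**: (L) implies the crux `TiltDominationLoc` (via `tiltDominationLoc_iff_oneSignedRigidity`,
p642489). [cite: KochNadirashviliSereginSverak2009, §1] -/
theorem tiltDominationLoc_of_liouvilleConjectureNS
    (hL : Summit.NavierStokesRegularity.NavierStokesRegularity.LiouvilleConjectureNS) : TiltDominationLoc :=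
  AxisTwistDoorTiltDominationLocRigidity.tiltDominationLoc_iff_oneSignedRigidity.2
    (oneSignedRigidity_of_liouvilleConjectureNS hL)

/-- **W3 ⟸ H2 by item name**: the route item `TypeILiouville.TypeIliouvilleL` (stmt-NavierStokesRegularity-10661,
definitionally the leaf `LiouvilleConjectureNS`) implies the crux `TiltDominationLoc` (stmt-26991). [cite:
KochNadirashviliSereginSverak2009, §1] -/
theorem tiltDominationLoc_of_typeIliouvilleL
    (hL : Summit.NavierStokesRegularity.NavierStokesRegularity.Theses.TypeILiouville.TypeIliouvilleL) :
    TiltDominationLoc :=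
  tiltDominationLoc_of_liouvilleConjectureNS fun u hu hmeas t ht => hL u hu hmeas t ht

/-! ### Appended (LEAD g4, after K2-p2 g10's `…PoloidalWindowDoorOfNoLocalTypeI`, p648936): W3 ⟸ «no local Type-I
singularity exists» (Albritton–Barker 2019 Thm 1.1, bullet 1) -/

/-- **W3 ⟸ ¬LocalTypeISingularityExists.**  If no suitable weak solution has a Type-I singular point
(`¬ LocalTypeISingularityExists`, Albritton–Barker 2019 Thm 1.1 bullet 1), every profile of the route's class vanishes
(K2-p2's `class_eq_zero_of_not_localTypeISingularityExists`: a non-zero class profile, time-shifted, witnesses bullet 2,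
and the tree's `AlbrittonBarkerTypeICharacterization_holds` converts), hence `OneSignedRigidity`. [cite: AlbrittonBarker2019,
Thm 1.1] -/
theorem oneSignedRigidity_of_not_localTypeISingularityExists (hN : ¬ LocalTypeISingularityExists) : OneSignedRigidity :=
  fun _ _ _ _ hrate hcont hmild hdiv _ _ _ _ _ =>
    AxisTwistDoorTiltDominationLocSymmetryExclusions.not_isBackwardSingularPoint_of_eq_zero
      (PoloidalWindowDoorOfNoLocalTypeI.class_eq_zero_of_not_localTypeISingularityExists hN hrate hcont hmild hdiv)

/-- **Crux form**: `¬ LocalTypeISingularityExists → TiltDominationLoc` (board edge: W3 sits under «no Type-I singularity», as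
do W4/`LrcModEntire`/`Target` of PoloidalWindowDoor by K2-p2's file). [cite: AlbrittonBarker2019, Thm 1.1] -/
theorem tiltDominationLoc_of_not_localTypeISingularityExists (hN : ¬ LocalTypeISingularityExists) : TiltDominationLoc :=
  AxisTwistDoorTiltDominationLocRigidity.tiltDominationLoc_iff_oneSignedRigidity.2
    (oneSignedRigidity_of_not_localTypeISingularityExists hN)

end Summit.NavierStokesRegularity.NavierStokesRegularity.Theorems.AxisTwistDoorTiltDominationLocOfLiouville

end
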